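import Mathlib
import HarnessLib

/-!
# Nikolskii-type inequality for a finite family of continuous functions

On the span of finitely many continuous functions `ψ₁, …, ψ_N : Ω → ℂ` bounded by `1`, over a
topological space carrying a finite measure `μ` that charges every non-empty open set, the sup
norm is dominated by the `L²(μ)` mass:

* `nikolskii_finite_family` — `∃ C > 0, ∀ c ω, ‖Σ_k c_k ψ_k(ω)‖² ≤ C ∫ ‖Σ_k c_k ψ_k‖² dμ`;
* `nikolskii_mvPolynomial` — the same for all polynomials of total degree `≤ d` evaluated at
  finitely many continuous coordinate functions of modulus `≤ 1` (e.g. matrix entries of compact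
  matrix groups and their inverses: band-limited functions on `SU(N)^k` under Haar measure).

This is the qualitative ("finite-dimensional") Nikolskii inequality: all norms on a
finite-dimensional space are equivalent, and `f ↦ (∫|f|²)^{1/2}` is a norm on the span because a
continuous function vanishing `μ`-a.e. vanishes identically when `μ` has full support.  The proof
is elementary (pointwise kernel = `L²` kernel via `Continuous.ae_eq_iff_eq`; a linear complement
of the kernel; the `L²` form is positive definite there, hence bounded below on the compact unit
sphere).  Quantitative versions with explicit constants (degree-dependent Nikolskii constants for
trigonometric / algebraic polynomials, Borwein–Erdélyi, *Polynomials and Polynomial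
Inequalities*, GTM 161, §5.1 and App. A4) are NOT here; the constant produced is inexplicit.
-/

namespace Literature.Analysis.Approximation

open _root_.MeasureTheory Metric
open scoped BigOperators ComplexConjugate

variable {Ω : Type*} [TopologicalSpace Ω] [MeasurableSpace Ω] [OpensMeasurableSpace Ω]
variable {ι : Type*} [Fintype ι]

omit [TopologicalSpace Ω] [MeasurableSpace Ω] [OpensMeasurableSpace Ω] in
/-- `‖Σ_k c_k ψ_k(ω)‖ ≤ Σ_k ‖c_k‖` when `‖ψ_k‖ ≤ 1`. [folklore] -/
theorem norm_eval_family_le (ψ : ι → Ω → ℂ) (hb : ∀ k ω, ‖ψ k ω‖ ≤ 1) (c : ι → ℂ) (ω : Ω) :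
    ‖∑ k, c k * ψ k ω‖ ≤ ∑ k, ‖c k‖ := by
  refine (norm_sum_le _ _).trans (Finset.sum_le_sum fun k _ => ?_)
  rw [norm_mul]
  calc ‖c k‖ * ‖ψ k ω‖ ≤ ‖c k‖ * 1 := by gcongr; exact hb k ω
    _ = ‖c k‖ := mul_one _

omit [TopologicalSpace Ω] [MeasurableSpace Ω] [OpensMeasurableSpace Ω] in
/-- `‖Σ_k c_k ψ_k(ω)‖ ≤ N ‖c‖` (sup norm) when `‖ψ_k‖ ≤ 1`. [folklore] -/
theorem norm_eval_family_le_card_mul (ψ : ι → Ω → ℂ) (hb : ∀ k ω, ‖ψ k ω‖ ≤ 1) (c : ι → ℂ)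
    (ω : Ω) : ‖∑ k, c k * ψ k ω‖ ≤ Fintype.card ι * ‖c‖ := by
  refine (norm_eval_family_le ψ hb c ω).trans ?_
  calc ∑ k, ‖c k‖ ≤ ∑ _k : ι, ‖c‖ := Finset.sum_le_sum fun k _ => norm_le_pi_norm c k
    _ = Fintype.card ι * ‖c‖ := by simp

omit [TopologicalSpace Ω] [MeasurableSpace Ω] [OpensMeasurableSpace Ω] in
/-- The span map `c ↦ (ω ↦ Σ_k c_k ψ_k ω)` as a `ℂ`-linear map into functions. [folklore] -/
theorem evalFamily_linear (ψ : ι → Ω → ℂ) :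
    ∃ Φ : (ι → ℂ) →ₗ[ℂ] (Ω → ℂ), ∀ c ω, Φ c ω = ∑ k, c k * ψ k ω :=
  ⟨{ toFun := fun c ω => ∑ k, c k * ψ k ω
     map_add' := fun c d => by ext ω; simp [add_mul, Finset.sum_add_distrib]
     map_smul' := fun t c => by ext ω; simp [Finset.mul_sum, mul_assoc] },
    fun _ _ => rfl⟩

/-- **Abstract Nikolskii inequality.** For finitely many continuous functions `ψ_k : Ω → ℂ`
bounded by `1`, and a finite measure `μ` charging every non-empty open set, the sup of any
linear combination is controlled by its `L²(μ)`-mass, with a constant depending only on the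
family. [folklore] -/
theorem nikolskii_finite_family (μ : Measure Ω) [IsFiniteMeasure μ] [μ.IsOpenPosMeasure]
    (ψ : ι → Ω → ℂ) (hc : ∀ k, Continuous (ψ k)) (hb : ∀ k ω, ‖ψ k ω‖ ≤ 1) :
    ∃ C : ℝ, 0 < C ∧ ∀ (c : ι → ℂ) (ω : Ω),
      ‖∑ k, c k * ψ k ω‖ ^ 2 ≤ C * ∫ ω', ‖∑ k, c k * ψ k ω'‖ ^ 2 ∂μ := by
  classical
  obtain ⟨Φ, hΦ⟩ := evalFamily_linear ψ
  set N : ℝ := (Fintype.card ι : ℝ) with hN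
  -- continuity and integrability of the combinations
  have hcont : ∀ c : ι → ℂ, Continuous fun ω => ∑ k, c k * ψ k ω := fun c =>
    continuous_finsetSum _ fun k _ => continuous_const.mul (hc k)
  have hbound : ∀ (c : ι → ℂ) (ω : Ω), ‖∑ k, c k * ψ k ω‖ ^ 2 ≤ (N * ‖c‖) ^ 2 := fun c ω =>
    pow_le_pow_left₀ (norm_nonneg _) (norm_eval_family_le_card_mul ψ hb c ω) 2
  have hint : ∀ c : ι → ℂ, Integrable (fun ω => ‖∑ k, c k * ψ k ω‖ ^ 2) μ := fun c =>
    (integrable_const ((N * ‖c‖) ^ 2)).mono' ((hcont c).norm.pow 2).aestronglyMeasurable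
      (ae_of_all _ fun ω => by
        rw [Real.norm_eq_abs, abs_of_nonneg (by positivity)]; exact hbound c ω)
  -- the L² mass as a function of the coefficients
  set q : (ι → ℂ) → ℝ := fun c => ∫ ω', ‖∑ k, c k * ψ k ω'‖ ^ 2 ∂μ with hq
  have hq0 : ∀ c : ι → ℂ, 0 ≤ q c := fun c => integral_nonneg fun ω => by positivity
  -- homogeneity under complex scalars
  have hqsmul : ∀ (t : ℂ) (c : ι → ℂ), q (t • c) = ‖t‖ ^ 2 * q c := by
    intro t c
    simp only [hq, Pi.smul_apply, smul_eq_mul]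
    rw [← integral_const_mul]
    refine integral_congr_ae (ae_of_all _ fun ω => ?_)
    simp only [mul_assoc, ← Finset.mul_sum, norm_mul, mul_pow]
  -- the pointwise kernel and a complement
  set K : Submodule ℂ (ι → ℂ) := LinearMap.ker Φ with hK
  obtain ⟨K', hKK'⟩ := K.exists_isCompl
  -- positivity of q on K' \ {0}
  have hqpos : ∀ b ∈ K', b ≠ 0 → 0 < q b := by
    intro b hb' hb0
    refine lt_of_le_of_ne (hq0 b) fun h0 => hb0 ?_
    have hae : (fun ω => ‖∑ k, b k * ψ k ω‖ ^ 2) =ᵐ[μ] 0 :=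
      (integral_eq_zero_iff_of_nonneg (fun ω => by positivity) (hint b)).1 h0.symm
    have hzero : (fun ω => ‖∑ k, b k * ψ k ω‖ ^ 2) = fun _ => (0 : ℝ) :=
      (Continuous.ae_eq_iff_eq μ ((hcont b).norm.pow 2) continuous_const).1 hae
    have hΦb : Φ b = 0 := by
      ext ω
      have := congr_fun hzero ω
      simp only [pow_eq_zero_iff, ne_eq, OfNat.ofNat_ne_zero, not_false_eq_true, norm_eq_zero]
        at this
      rw [hΦ]; simpa using this
    have hbK : b ∈ K := by rw [hK, LinearMap.mem_ker]; exact hΦb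
    have : b ∈ K ⊓ K' := ⟨hbK, hb'⟩
    rw [hKK'.inf_eq_bot, Submodule.mem_bot] at this
    exact this
  -- the unit sphere of K' is compact; q is continuous there and bounded below by some λ > 0
  set S : Set (ι → ℂ) := {b | b ∈ K' ∧ ‖b‖ = 1} with hS
  have hScpt : IsCompact S := by
    refine (isCompact_closedBall (0 : ι → ℂ) 1).of_isClosed_subset ?_ ?_
    · have h1 : IsClosed (K' : Set (ι → ℂ)) := K'.closed_of_finiteDimensional
      have h2 : IsClosed {b : ι → ℂ | ‖b‖ = 1} := isClosed_eq continuous_norm continuous_const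
      simpa [hS, Set.setOf_and] using h1.inter h2
    · intro b hb'; simp only [hS, Set.mem_setOf_eq] at hb'
      simp [hb'.2]
  have hqcont : ContinuousOn q S := by
    have hB : ContinuousOn q (closedBall (0 : ι → ℂ) 1) := by
      refine continuousOn_of_dominated (bound := fun _ => N ^ 2) ?_ ?_ ?_ ?_
      · exact fun c _ => ((hcont c).norm.pow 2).aestronglyMeasurable
      · intro c hc1
        refine ae_of_all _ fun ω => ?_
        rw [Real.norm_eq_abs, abs_of_nonneg (by positivity)]
        refine (hbound c ω).trans ?_
        have : ‖c‖ ≤ 1 := by simpa using hc1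
        have hN0 : 0 ≤ N := by positivity
        calc (N * ‖c‖) ^ 2 ≤ (N * 1) ^ 2 := by gcongr
          _ = N ^ 2 := by ring
      · exact integrable_const _
      · refine ae_of_all _ fun ω => ?_
        exact ((continuous_finsetSum _ fun k _ =>
          ((continuous_apply k).mul continuous_const)).norm.pow 2).continuousOn
    exact hB.mono fun b hb' => by
      simp only [hS, Set.mem_setOf_eq] at hb'
      simp [hb'.2]
  have hlam : ∃ lam : ℝ, 0 < lam ∧ ∀ b ∈ S, lam ≤ q b := by
    rcases S.eq_empty_or_nonempty with hSe | hSne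
    · exact ⟨1, one_pos, fun b hb' => by simp [hSe] at hb'⟩
    · obtain ⟨b₀, hb₀S, hmin⟩ := hScpt.exists_isMinOn hSne hqcont
      refine ⟨q b₀, hqpos b₀ hb₀S.1 ?_, fun b hb' => hmin hb'⟩
      intro h0; have := hb₀S.2; simp [h0] at this
  obtain ⟨lam, hlam0, hlamS⟩ := hlam
  -- lower bound q b ≥ lam ‖b‖² on K'
  have hqlow : ∀ b ∈ K', lam * ‖b‖ ^ 2 ≤ q b := by
    intro b hb'
    by_cases hb0 : b = 0
    · simp [hb0, hq0]
    · have hnb : 0 < ‖b‖ := norm_pos_iff.2 hb0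
      set u : ι → ℂ := ((‖b‖⁻¹ : ℝ) : ℂ) • b with hu
      have huK' : u ∈ K' := K'.smul_mem _ hb'
      have hun : ‖u‖ = 1 := by
        rw [hu, norm_smul, Complex.norm_real, Real.norm_eq_abs, abs_of_pos (inv_pos.2 hnb),
          inv_mul_cancel₀ hnb.ne']
      have hqu : q u = ‖b‖⁻¹ ^ 2 * q b := by
        rw [hu, hqsmul, Complex.norm_real, Real.norm_eq_abs, abs_of_pos (inv_pos.2 hnb)]
      have := hlamS u ⟨huK', hun⟩
      calc lam * ‖b‖ ^ 2 ≤ q u * ‖b‖ ^ 2 := by gcongr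
        _ = q b := by rw [hqu]; field_simp
  -- assemble
  refine ⟨N ^ 2 / lam + 1, by positivity, fun c ω => ?_⟩
  have hc_top : c ∈ K ⊔ K' := by rw [hKK'.sup_eq_top]; exact Submodule.mem_top
  obtain ⟨a, ha, b, hb', rfl⟩ := Submodule.mem_sup.1 hc_top
  have hΦa : ∀ ω', ∑ k, a k * ψ k ω' = 0 := fun ω' => by
    have : Φ a = 0 := LinearMap.mem_ker.1 (by rw [hK] at ha; exact ha)
    rw [← hΦ, this]; rfl
  have hsum : ∀ ω', ∑ k, (a + b) k * ψ k ω' = ∑ k, b k * ψ k ω' := fun ω' => by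
    simp only [Pi.add_apply, add_mul, Finset.sum_add_distrib, hΦa ω', zero_add]
  simp only [hsum]
  have h1 : ‖∑ k, b k * ψ k ω‖ ^ 2 ≤ N ^ 2 * ‖b‖ ^ 2 := by
    rw [← mul_pow]; exact hbound b ω
  have h2 : lam * ‖b‖ ^ 2 ≤ q b := hqlow b hb'
  have hqb : 0 ≤ q b := hq0 b
  calc ‖∑ k, b k * ψ k ω‖ ^ 2 ≤ N ^ 2 * ‖b‖ ^ 2 := h1
    _ ≤ N ^ 2 / lam * q b := by
        rw [div_mul_eq_mul_div, le_div_iff₀ hlam0]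
        nlinarith [sq_nonneg N, mul_le_mul_of_nonneg_left h2 (sq_nonneg N)]
    _ ≤ (N ^ 2 / lam + 1) * q b := by nlinarith [div_nonneg (sq_nonneg N) hlam0.le]

/-! ### Polynomial form: bounded total degree, coordinates bounded by one -/

/-- The exponent box `{m | ∀ v, m v ≤ d}` as a finset of finitely supported functions. [folklore] -/
theorem mem_exponentBox_of_totalDegree_le {σ : Type*} [Fintype σ] [DecidableEq σ] (d : ℕ)
    (P : MvPolynomial σ ℂ) (hP : P.totalDegree ≤ d) (m : σ →₀ ℕ) (hm : m ∈ P.support) :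
    m ∈ (Fintype.piFinset fun _ : σ => Finset.range (d + 1)).image
      (Finsupp.equivFunOnFinite.symm : (σ → ℕ) → σ →₀ ℕ) := by
  refine Finset.mem_image.2 ⟨m, ?_, by simp⟩
  refine Fintype.mem_piFinset.2 fun v => Finset.mem_range.2 (Nat.lt_succ_of_le ?_)
  calc m v ≤ m.sum fun _ e => e := by
        by_cases hv : v ∈ m.support
        · exact Finset.single_le_sum (fun _ _ => Nat.zero_le _) hv
        · rw [Finsupp.notMem_support_iff.1 hv]; exact Nat.zero_le _
    _ ≤ P.totalDegree := MvPolynomial.le_totalDegree hm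
    _ ≤ d := hP

/-- **Nikolskii inequality for polynomials of bounded total degree in coordinates of modulus
`≤ 1`.**  If `θ : Ω → σ → ℂ` are finitely many continuous coordinate functions bounded by `1`
on a space with a finite measure charging open sets, then for every `d` there is `C > 0` with
`‖P(θ ω)‖² ≤ C ∫ ‖P(θ ·)‖² dμ` for every polynomial `P` of total degree `≤ d` and every `ω`. [folklore] -/
theorem nikolskii_mvPolynomial (μ : Measure Ω) [IsFiniteMeasure μ] [μ.IsOpenPosMeasure]
    {σ : Type*} [Fintype σ] [DecidableEq σ] (θ : Ω → σ → ℂ)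
    (hθc : ∀ v, Continuous fun ω => θ ω v) (hθb : ∀ ω v, ‖θ ω v‖ ≤ 1) (d : ℕ) :
    ∃ C : ℝ, 0 < C ∧ ∀ P : MvPolynomial σ ℂ, P.totalDegree ≤ d → ∀ ω : Ω,
      ‖MvPolynomial.eval (θ ω) P‖ ^ 2 ≤
        C * ∫ ω', ‖MvPolynomial.eval (θ ω') P‖ ^ 2 ∂μ := by
  classical
  -- the finite monomial family of the exponent box
  set B : Finset (σ →₀ ℕ) := (Fintype.piFinset fun _ : σ => Finset.range (d + 1)).image
      (Finsupp.equivFunOnFinite.symm : (σ → ℕ) → σ →₀ ℕ) with hB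
  set ψ : B → Ω → ℂ := fun m ω => ∏ v ∈ m.1.support, θ ω v ^ m.1 v with hψ
  have hψc : ∀ k, Continuous (ψ k) := fun k => by
    simp only [hψ]
    exact continuous_finsetProd _ fun v _ => (hθc v).pow _
  have hψb : ∀ k ω, ‖ψ k ω‖ ≤ 1 := fun k ω => by
    simp only [hψ, norm_prod, norm_pow]
    exact Finset.prod_le_one (fun v _ => by positivity) fun v _ => pow_le_one₀ (norm_nonneg _)
      (hθb ω v)
  obtain ⟨C, hC, hN⟩ := nikolskii_finite_family μ ψ hψc hψb
  refine ⟨C, hC, fun P hP ω => ?_⟩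
  -- expand `P` over the box
  have hsupp : P.support ⊆ B := fun m hm => mem_exponentBox_of_totalDegree_le d P hP m hm
  have hexp : ∀ ω', MvPolynomial.eval (θ ω') P = ∑ k : B, P.coeff k.1 * ψ k ω' := fun ω' => by
    have h1 : MvPolynomial.eval (θ ω') P =
        ∑ m ∈ P.support, P.coeff m * ∏ v ∈ m.support, θ ω' v ^ m v :=
      MvPolynomial.eval_eq (θ ω') P
    have h2 : ∑ m ∈ P.support, P.coeff m * ∏ v ∈ m.support, θ ω' v ^ m v
        = ∑ m ∈ B, P.coeff m * ∏ v ∈ m.support, θ ω' v ^ m v := by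
      refine Finset.sum_subset hsupp fun m _ hm => ?_
      rw [MvPolynomial.notMem_support_iff.1 hm, zero_mul]
    rw [h1, h2, ← Finset.sum_coe_sort]
  simp only [hexp]
  exact hN (fun k => P.coeff k.1) ω

end Literature.Analysis.Approximation
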